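import Summits.QuantumFields.YangMills.Theorems.BalabanUVNodesK0Stub1FlatCurrentA1LineRows
import Summits.QuantumFields.YangMills.Theorems.BalabanUVNodesK0Stub1SocketFlatAtRecordExists
import HarnessLib

/-!
# K0⁷ STUB 1 (`stub_prop8StepCoP13` ∕ V20-G `stub_prop8StepCoPG13`), S4b → S4a junction AT THE RECORD: **dag-k0-s1-w2's ♭ package p642782
# `exists_sectF_W_flatScaled_atRecord_socket` RE-EXPORTED VERBATIM PLUS THE A₁ LINE's THREE ROWS `hWq`, `hWA`, `hWtr`** for dag-k0-s1-w1's current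
# `W_A₁ Y := (i·c²·η^d·η⁻¹)•(W((iη)⁻¹•Y) − (N⁻¹tr W((iη)⁻¹•Y))•1)` (`c = L^{K−n}`, `η = L^{−(K−n)}`) — the rows of ✓`K0Stub1Letters10OnA1.exists_letters10On_A1_closed_of_adm22_T4`
# (`a₃ := η·ε`), by the generic rows of the companion file `…K0Stub1FlatCurrentA1LineRows` (§3) over §2's `herm0`-line reality of the current

Cell `pub-ymgap`, width seat `pub-ymgap-k0-s1-w4` g3 (CLAIM-1 part 2, bus 2026-08-28 14:49Z).  `--kind proof --supports stmt-QuantumFields-20541 --as helper`; count-neutral;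
def-free.  [15] = [Balaban1985Variational]; [B7] = [Balaban1985Averaging].

WHY ONE MORE SUPERSET.  Everything downstream of D‴ must be threaded through ONE `obtain` (the objects `τ, BE, B, M♭, H, Dsel, W, …` are ∃-bound): C″ → C‴ → D‴ →
p642782 (+ socket) → THIS FILE (+ the A₁ rows).  The A₁-line assembler at the ♭ road obtains THIS theorem once and feeds (i) `hWq hWA hWtr` to
`exists_letters10On_A1_closed_of_adm22_T4` and (ii) `hntr hBE hsock` to dag-k0-s1-w1's `h128_of_socket127_flat` ∕ `re_trace_pairing_rescaled_current_traceless` — same `W`,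
same `BE`, same `ε`.

WHAT IS PROVED (sorry-free; no definition; axioms standard).
* ★★★ `exists_sectF_W_flatScaled_atRecord_socket_A1rows (N) [NeZero N] (F : T4Family)` — p642782's statement VERBATIM (conjunct order `hntr hρ hBE hB hMV hH h55 hcd hfix hherm
  hQt hHt hDt he h157 hdiff h158 hsock`) ∧ `hWq` (window `r < η·ε`, gradient factor `F.L^{K−n}`, `ν : Fin 4`, constant `2·(c²η^dη⁻¹)·η⁻²·C₄`) ∧ (`hWA` ∧ `hWtr` at every
  `𝔰𝔲(N)`-valued `X` of rows `≤ ρ′ < η·ε`).  Proof: `obtain` p642782; `hWq` = §3 `row98_flatCurrentA1` on the (98) row `h158`; `hWA` = §3 `conjTranspose_flatCurrentA1_eq_neg` over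
  §2 `im_sum_trace_current_eq_zero_of_certificate_herm0` (certificate `h157`, reality `hreal_V80_herm0` from `hherm` + real kernels `hMV` ∕ `Qlin♭` + pv27's `V₀`); `hWtr` = §3.
HONEST SCOPE.  Bookkeeping ∕ `exact` assembly over p642782 and the companion file; the (98) row, the (157) certificate, the chart's reality and the socket are CONSUMED, not
proved here; NO estimate of [15]∕[B7] asserted; `h128`, the sizes, the slice (153) and the S6 budget stay with their owners; `stub_prop8StepCoP13` ∕ `stub_prop8StepCoPG13` ∕ K0⁷
NOT closed (ONE PEN: not this seat); N07 NOT discharged; no summit statement is proved by this seat; counts unmoved (28∕28 · 5∕27); one finite 𝕋⁴ programme at fixed ε — R4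
closes the conditional finite-𝕋⁴ rung `BalabanLadder.UV` only, never the summit; the YM mass gap (Clay) is NOT proved by any of this; nothing continuum ∕ ℝ⁴ ∕ OS.
No `sorry`, no `def`, no `instance`, no `notation`.

References: [15] (22) p.281, (27) p.282, (44)–(50) p.285, (55) p.286, (80) p.290, Prop. 4 (97)–(98) pp.292–293, Prop. 6 p.295, (127)–(128) p.297, (152) p.301, (156)–(158)
p.302; [B7] (17) p.20, (20) p.21, Prop. 5 (157) p.42; [Balaban1984PropagatorsII] (2.35) p.228, Cor. 2.8 p.249; [Balaban1987RG1] (0.1) p.251, (0.4) p.253.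
-/

set_option autoImplicit false

noncomputable section

open scoped BigOperators Matrix Matrix.Norms.L2Operator Topology InnerProductSpace RealInnerProductSpace ContDiff
open Filter

namespace Summit.QuantumFields.YangMills.Theorems.K0Stub1FlatCurrentA1LineRowsAtRecord

open Literature.MathematicalPhysics.QuantumFieldTheory.Balaban1983to89
open T4AdjointCovarianceUnitary (lieSU mem_lieSU_iff)
open B9AdOrthogonal (herm0 mem_herm0)
open MatrixNorms (ntr)
open Summit.QuantumFields.YangMills.Theorems.K0Stub1FlatCurrentA1LineRows
/-! ## At every admissible family of the record's four-tori: dag-k0-s1-w2's ♭ package (p642782) RE-EXPORTED WITH THE A₁ LINE's THREE ROWS -/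

section Record

open Literature.MathematicalPhysics.QuantumFieldTheory.Balaban1983to89.Node00
open T4Continuum (T4Family)
open B9Eq39Adjoint (bondPair)
open B15DeterminingSets (bondsOf DetSet avgFamily)
open B6SectADomainsV1 (Domains)
open B6SectAOperatorsV1 (BondIdx aE)
open B6SectAVectorModelV1 (EE)
open B11Eq26ActionExpansion (V0)
open B4Sect5Torus (TSite)
open Summit.QuantumFields.YangMills.Theorems.FlatCubeOpsText (Adm22)
open Summit.QuantumFields.YangMills.Theorems.K0FlatCubeOpsTextP (IsLevWeight flatH levWeight_nonneg)
open Summit.QuantumFields.YangMills.Theorems.Prop8Chart (expCfg)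
open Summit.QuantumFields.YangMills.Theorems.Prop8ChartDoubleBar (chartLogFlat)
open Summit.QuantumFields.YangMills.Theorems.K0Stub1SocketFlatAtRecordExists (exists_sectF_W_flatScaled_atRecord_socket)

/-- ★★★ **SECT. F's ♭ CURRENT AT THE RECORD — dag-k0-s1-w2's p642782 `exists_sectF_W_flatScaled_atRecord_socket` VERBATIM (objects, (55)♭∕analyticity∕(49)♭∕(48)♭,
reality on `herm0`, transposes, (157), window, (98) row, the ♭ (127) socket) PLUS THE A₁ LINE's THREE ROWS for dag-k0-s1-w1's current
`W_A₁ Y := (i·c²·η^d·η⁻¹)•(W((iη)⁻¹•Y) − (N⁻¹tr W((iη)⁻¹•Y))•1)` (`c = L^{K−n}` the A₁ line's lattice factor, `η = L^{−(K−n)}` the chart's):** `hWq` on the window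
`r < η·ε` with constant `2·(c²η^dη⁻¹)·η⁻²·C₄`, and `hWA` ∧ `hWtr` at every `𝔰𝔲(N)`-valued `X` of rows `≤ ρ′ < η·ε` — the shapes of
✓`K0Stub1Letters10OnA1.exists_letters10On_A1_closed_of_adm22_T4`'s `hWq hWA hWtr` (`a₃ := η·ε`); ONE `obtain` for the A₁-line assembler (objects shared with the socket
that feeds dag-k0-s1-w1's `h128_of_socket127_flat`). [cite: Balaban1985Variational, (22) p.281, (27) p.282, Prop. 4 (97)-(98) pp.292-293, Prop. 6 p.295, (127)-(128) p.297, (152) p.301, (156)-(158) p.302; Balaban1985Averaging, (17) p.20, (20) p.21] -/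
theorem exists_sectF_W_flatScaled_atRecord_socket_A1rows (N : ℕ) [NeZero N] (F : T4Family) :
    ∃ (Mh₀ R₀ : ℕ) (ε C₄ : ℝ), 0 < ε ∧ 0 ≤ C₄ ∧
    ∀ (n K : ℕ) (_ : 1 ≤ K - n) (_ : K - n + 1 ≤ F.m + K) {Mh R a' : ℕ} (_ : Mh = F.L ^ a') (_ : Mh₀ ≤ Mh) (_ : R₀ ≤ R)
      (_ : a' + 3 ≤ F.m + n) (D : Domains (F.P K)) (_ : D.k = K - n) (_ : Adm22 D R (F.L * Mh))
      {w : ℕ → PBond (F.P K) 0 → ℝ} (_ : IsLevWeight (F.P K) (K - n) D w),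
    ∃ (τ : Matrix (Fin N) (Fin N) ℂ →L[ℂ] ℂ) (ρ : (Matrix (Fin N) (Fin N) ℂ →L[ℂ] ℂ) →L[ℂ] Matrix (Fin N) (Fin N) ℂ)
      (BE : (PBond (F.P K) 0 → Matrix (Fin N) (Fin N) ℂ) →L[ℂ] (PBond (F.P K) 0 → Matrix (Fin N) (Fin N) ℂ) →L[ℂ] ℂ)
      (B : (BondIdx D → Matrix (Fin N) (Fin N) ℂ) →L[ℂ] (BondIdx D → Matrix (Fin N) (Fin N) ℂ) →L[ℂ] ℂ)
      (hc : ((F.P K).L : ℝ) ^ (K - n) ≠ 0) (hwa : ∀ _i : BondIdx D, (0 : ℝ) < 1)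
      (MV : (BondIdx D → Matrix (Fin N) (Fin N) ℂ) →L[ℂ] (BondIdx D → Matrix (Fin N) (Fin N) ℂ))
      (H : (BondIdx D → Matrix (Fin N) (Fin N) ℂ) →ₗ[ℂ] (PBond (F.P K) 0 → Matrix (Fin N) (Fin N) ℂ))
      (Dsel : (PBond (F.P K) 0 → Matrix (Fin N) (Fin N) ℂ) → (BondIdx D → Matrix (Fin N) (Fin N) ℂ))
      (Qt : (BondIdx D → Matrix (Fin N) (Fin N) ℂ) →L[ℂ] (PBond (F.P K) 0 → Matrix (Fin N) (Fin N) ℂ))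
      (Ht : (PBond (F.P K) 0 → Matrix (Fin N) (Fin N) ℂ) →L[ℂ] (BondIdx D → Matrix (Fin N) (Fin N) ℂ))
      (Dt : (PBond (F.P K) 0 → Matrix (Fin N) (Fin N) ℂ) → ((BondIdx D → Matrix (Fin N) (Fin N) ℂ) →L[ℂ] (PBond (F.P K) 0 → Matrix (Fin N) (Fin N) ℂ)))
      (e : Site (F.P K) 0 ≃ TSite (F.P K).d (fun _ => (F.P K).sitesPerDir 0))
      (W : (PBond (F.P K) 0 → Matrix (Fin N) (Fin N) ℂ) → (PBond (F.P K) 0 → Matrix (Fin N) (Fin N) ℂ)),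
      -- the objects of record
      (∀ X, τ X = ntr X) ∧ (∀ (ℓ' : Matrix (Fin N) (Fin N) ℂ →L[ℂ] ℂ) (X : Matrix (Fin N) (Fin N) ℂ), τ (ρ ℓ' * X) = ℓ' X) ∧
      (∀ Y δ : PBond (F.P K) 0 → Matrix (Fin N) (Fin N) ℂ, BE Y δ =
        bondPair ((((F.P K).L : ℝ))⁻¹ ^ (K - n)) (F.P K).d (τ : Matrix (Fin N) (Fin N) ℂ →ₗ[ℂ] ℂ) (fun μ x => Y ⟨x, μ⟩) (fun μ x => δ ⟨x, μ⟩)) ∧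
      (∀ X X' : BondIdx D → Matrix (Fin N) (Fin N) ℂ, B X X' = ∑ t, τ (X t * X' t)) ∧
      (∀ (X : BondIdx D → Matrix (Fin N) (Fin N) ℂ) (t : BondIdx D),
        MV X t = ∑ s, (((((F.P K).L : ℝ) ^ (t.1.1 : ℕ) * ((((F.P K).L : ℝ))⁻¹) ^ (K - n))⁻¹ *
          WithLp.ofLp ((EE D hc hwa - aE D (fun _ => (1 : ℝ))) (WithLp.toLp 2 (Pi.single s 1))) t *
          (((F.P K).L : ℝ) ^ (s.1.1 : ℕ) * ((((F.P K).L : ℝ))⁻¹) ^ (K - n))⁻¹ : ℝ) : ℂ) • X s) ∧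
      (∀ (X : BondIdx D → Matrix (Fin N) (Fin N) ℂ) (b : PBond (F.P K) 0), H X b =
        ∑ t, (((((F.P K).L : ℝ) ^ (t.1.1 : ℕ) * ((((F.P K).L : ℝ))⁻¹) ^ (K - n))⁻¹ * flatH (F.P K) (K - n) D (Pi.single t 1) b : ℝ) : ℂ) • X t) ∧
      -- the implicit ♭ chart on the `ε`-ball: (55)♭, analyticity, (49)♭, (48)♭
      (∀ A' : PBond (F.P K) 0 → Matrix (Fin N) (Fin N) ℂ, (∀ b, w 1 b * ‖A' b‖ < ε) →
        ∀ ρ' : ℝ, 0 ≤ ρ' → (∀ b, w 1 b * ‖A' b‖ ≤ ρ') → ∀ i : BondIdx D, ‖Dsel A' i‖ ≤ C₄ * ρ' ^ 2) ∧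
      ContDiffOn ℂ ω Dsel {Y : PBond (F.P K) 0 → Matrix (Fin N) (Fin N) ℂ | ∀ b, w 1 b * ‖Y b‖ < ε} ∧
      (∀ A' : PBond (F.P K) 0 → Matrix (Fin N) (Fin N) ℂ, (∀ b, w 1 b * ‖A' b‖ < ε) →
        chartLogFlat (((((F.P K).L : ℝ))⁻¹) ^ (K - n)) D (A' - H (Dsel A')) - (fderiv ℂ (chartLogFlat (((((F.P K).L : ℝ))⁻¹) ^ (K - n)) D :
        (PBond (F.P K) 0 → Matrix (Fin N) (Fin N) ℂ) → BondIdx D → Matrix (Fin N) (Fin N) ℂ) 0) (A' - H (Dsel A')) = Dsel A' ∧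
        chartLogFlat (((((F.P K).L : ℝ))⁻¹) ^ (K - n)) D (A' - H (Dsel A')) = (fderiv ℂ (chartLogFlat (((((F.P K).L : ℝ))⁻¹) ^ (K - n)) D :
        (PBond (F.P K) 0 → Matrix (Fin N) (Fin N) ℂ) → BondIdx D → Matrix (Fin N) (Fin N) ℂ) 0) A') ∧
      -- the reality of the implicit ♭ chart on Hermitian-traceless fields (dag-k0-s1-w4 CLAIM-8, threaded through C‴)
      (∀ A' : PBond (F.P K) 0 → Matrix (Fin N) (Fin N) ℂ, (∀ b, w 1 b * ‖A' b‖ < ε) → (∀ b, A' b ∈ herm0 (Fin N)) →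
        (∀ i, Dsel A' i ∈ herm0 (Fin N)) ∧ ∀ b, (A' - H (Dsel A')) b ∈ herm0 (Fin N)) ∧
      -- the transposes
      (∀ X δ, BE (Qt X) δ = B X ((fderiv ℂ (chartLogFlat (((((F.P K).L : ℝ))⁻¹) ^ (K - n)) D :
        (PBond (F.P K) 0 → Matrix (Fin N) (Fin N) ℂ) → BondIdx D → Matrix (Fin N) (Fin N) ℂ) 0) δ)) ∧
      (∀ Z X, BE Z (H X) = B (Ht Z) X) ∧
      (∀ (A' : PBond (F.P K) 0 → Matrix (Fin N) (Fin N) ℂ) X δ, BE (Dt A' X) δ = B X (fderiv ℂ Dsel A' δ)) ∧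
      -- the chart, (157), the window, the (158)∕(98) row
      (∀ (x : Site (F.P K) 0) (μ : Fin (F.P K).d), e (x.shift μ) = B9SectCLatticeCarrier.shift μ (e x)) ∧
      (∀ A' : PBond (F.P K) 0 → Matrix (Fin N) (Fin N) ℂ, (∀ b, w 1 b * ‖A' b‖ < ε) →
        (∀ (b : PBond (F.P K) 0) (ν : Fin (F.P K).d), w 2 b * ((F.P K).L : ℝ) ^ (K - n) * ‖A' ⟨b.src.shift ν, b.dir⟩ - A' b‖ < ε) →
        HasFDerivAt (fun A : PBond (F.P K) 0 → Matrix (Fin N) (Fin N) ℂ => 2⁻¹ * B (Dsel A) (((((((((F.P K).L : ℝ))⁻¹) ^ (K - n) : ℝ) : ℂ) ^ (F.P K).d) • MV) (Dsel A))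
            - B ((fderiv ℂ (chartLogFlat (((((F.P K).L : ℝ))⁻¹) ^ (K - n)) D :
        (PBond (F.P K) 0 → Matrix (Fin N) (Fin N) ℂ) → BondIdx D → Matrix (Fin N) (Fin N) ℂ) 0) A)
                (((((((((F.P K).L : ℝ))⁻¹) ^ (K - n) : ℝ) : ℂ) ^ (F.P K).d) • MV) (Dsel A))
            + V0 (LatticeFieldCalculus.shiftEquiv (P := F.P K) (j := 0)) (fun _ _ => (1 : (Matrix (Fin N) (Fin N) ℂ)ˣ)) ((((F.P K).L : ℝ)⁻¹) ^ (K - n)) (F.P K).d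
                (τ : Matrix (Fin N) (Fin N) ℂ →ₗ[ℂ] ℂ) (fun μ x => (A - H (Dsel A)) ⟨x, μ⟩))
          (BE (W A')) A') ∧
      DifferentiableOn ℂ W {Y : PBond (F.P K) 0 → Matrix (Fin N) (Fin N) ℂ | (∀ b, w 1 b * ‖Y b‖ < ε) ∧
        ∀ (b : PBond (F.P K) 0) (ν : Fin (F.P K).d), w 2 b * ((F.P K).L : ℝ) ^ (K - n) * ‖Y ⟨b.src.shift ν, b.dir⟩ - Y b‖ < ε} ∧
      (∀ (Y : PBond (F.P K) 0 → Matrix (Fin N) (Fin N) ℂ) (r : ℝ), r < ε → (∀ b, w 1 b * ‖Y b‖ ≤ r) →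
        (∀ (b : PBond (F.P K) 0) (ν : Fin (F.P K).d), w 2 b * ((F.P K).L : ℝ) ^ (K - n) * ‖Y ⟨b.src.shift ν, b.dir⟩ - Y b‖ ≤ r) →
        ∀ b, w 3 b * ‖W Y b‖ ≤ C₄ * r ^ 2) ∧
      -- ★ THE ♭ (127) SOCKET: small Hermitian-traceless base points whose charted configuration is critical on the record's fibre, kernel directions
      (∀ (A₁ δ : PBond (F.P K) 0 → Matrix (Fin N) (Fin N) ℂ), (∀ b, w 1 b * ‖A₁ b‖ < ε) →
        (∀ (b : PBond (F.P K) 0) (ν : Fin (F.P K).d), w 2 b * ((F.P K).L : ℝ) ^ (K - n) * ‖A₁ ⟨b.src.shift ν, b.dir⟩ - A₁ b‖ < ε) →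
        (∀ b, A₁ b ∈ herm0 (Fin N)) → (∀ b, δ b ∈ herm0 (Fin N)) →
        (fderiv ℂ (chartLogFlat (((((F.P K).L : ℝ))⁻¹) ^ (K - n)) D :
          (PBond (F.P K) 0 → Matrix (Fin N) (Fin N) ℂ) → BondIdx D → Matrix (Fin N) (Fin N) ℂ) 0) δ = 0 →
        ∀ (𝔹 : DetSet (F.P K)), (∀ (j : ℕ) (b : PBond (F.P K) j), b ∈ bondsOf (𝔹 j) → j ≤ K - n ∧ D.LamBond j b) →
        ∀ (U₁ : GaugeField (F.P K) 0 (SU N)),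
          (∀ b, ((U₁ b : SU N) : Matrix (Fin N) (Fin N) ℂ) = ((expCfg ((((F.P K).L : ℝ)⁻¹) ^ (K - n)) (A₁ - H (Dsel A₁)) b : (Matrix (Fin N) (Fin N) ℂ)ˣ) : _)) →
          IsCritOnFibre F N K 𝔹 (avgFamily (avOfRecord F N K) U₁) U₁ →
        ∀ (X₁ δX : TangentBondSU (F.P K) 0 N),
          (∀ b, ((X₁ b : lieSU (Fin N)) : Matrix (Fin N) (Fin N) ℂ) = (Complex.I * (((((F.P K).L : ℝ)⁻¹) ^ (K - n) : ℝ) : ℂ)) • A₁ b) →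
          (∀ b, ((δX b : lieSU (Fin N)) : Matrix (Fin N) (Fin N) ℂ) = (Complex.I * (((((F.P K).L : ℝ)⁻¹) ^ (K - n) : ℝ) : ℂ)) • δ b) →
          ⟪δX, hessOpAt ((((F.P K).L : ℝ)⁻¹) ^ (K - n)) (1 : GaugeField (F.P K) 0 (SU N)) X₁⟫_ℝ + (BE (W A₁) δ).re = 0) ∧
      -- ★ dag-k0-s1-w4 g3: THE A₁ LINE's ROWS for dag-k0-s1-w1's current `W_A₁ Y := (i·c²·η^d·η⁻¹)•(W((iη)⁻¹•Y))♮` (`c = L^{K−n}`, `η = L^{−(K−n)}`): `hWq` on the window `r < η·ε` …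
      (∀ (Y : PBond (F.P K) 0 → Matrix (Fin N) (Fin N) ℂ) (r : ℝ), r < ((((F.P K).L : ℝ)⁻¹) ^ (K - n)) * ε → (∀ b, w 1 b * ‖Y b‖ ≤ r) →
        (∀ (b : PBond (F.P K) 0) (ν : Fin 4), w 2 b * (F.L : ℝ) ^ (K - n) * ‖Y ⟨b.src.shift ν, b.dir⟩ - Y b‖ ≤ r) →
        ∀ b, w 3 b * ‖(Complex.I * ((((F.P K).L ^ (K - n) : ℝ)) : ℂ) ^ 2 * (((((F.P K).L : ℝ)⁻¹) ^ (K - n) : ℝ) : ℂ) ^ (F.P K).d * ((((((F.P K).L : ℝ)⁻¹) ^ (K - n) : ℝ) : ℂ))⁻¹) •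
          (W (fun b' => (Complex.I * (((((F.P K).L : ℝ)⁻¹) ^ (K - n) : ℝ) : ℂ))⁻¹ • Y b') b - (((N : ℂ))⁻¹ * (W (fun b' => (Complex.I * (((((F.P K).L : ℝ)⁻¹) ^ (K - n) : ℝ) : ℂ))⁻¹ • Y b') b).trace) • (1 : Matrix (Fin N) (Fin N) ℂ))‖ ≤ (2 * (((F.P K).L ^ (K - n) : ℝ) ^ 2 * ((((F.P K).L : ℝ)⁻¹) ^ (K - n)) ^ (F.P K).d * ((((F.P K).L : ℝ)⁻¹) ^ (K - n))⁻¹) * ((((F.P K).L : ℝ)⁻¹) ^ (K - n))⁻¹ ^ 2 * C₄) * r ^ 2) ∧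
      -- … and `hWA` ∧ `hWtr` at every `𝔰𝔲(N)`-valued `X` whose Hermitian letter `(iη)⁻¹•X` lies in the two-size window (`ρ′ < η·ε`)
      (∀ (X : PBond (F.P K) 0 → lieSU (Fin N)) (ρ' : ℝ), ρ' < ((((F.P K).L : ℝ)⁻¹) ^ (K - n)) * ε →
        (∀ b, w 1 b * ‖((X b : lieSU (Fin N)) : Matrix (Fin N) (Fin N) ℂ)‖ ≤ ρ') →
        (∀ (b : PBond (F.P K) 0) (ν : Fin 4), w 2 b * (F.L : ℝ) ^ (K - n) *
          ‖((X ⟨b.src.shift ν, b.dir⟩ : lieSU (Fin N)) : Matrix (Fin N) (Fin N) ℂ) - ((X b : lieSU (Fin N)) : Matrix (Fin N) (Fin N) ℂ)‖ ≤ ρ') →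
        (∀ j, ((Complex.I * ((((F.P K).L ^ (K - n) : ℝ)) : ℂ) ^ 2 * (((((F.P K).L : ℝ)⁻¹) ^ (K - n) : ℝ) : ℂ) ^ (F.P K).d * ((((((F.P K).L : ℝ)⁻¹) ^ (K - n) : ℝ) : ℂ))⁻¹) •
            (W (fun b => (Complex.I * (((((F.P K).L : ℝ)⁻¹) ^ (K - n) : ℝ) : ℂ))⁻¹ • ((X b : lieSU (Fin N)) : Matrix (Fin N) (Fin N) ℂ)) j - (((N : ℂ))⁻¹ * (W (fun b => (Complex.I * (((((F.P K).L : ℝ)⁻¹) ^ (K - n) : ℝ) : ℂ))⁻¹ • ((X b : lieSU (Fin N)) : Matrix (Fin N) (Fin N) ℂ)) j).trace) • (1 : Matrix (Fin N) (Fin N) ℂ)))ᴴ =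
          -((Complex.I * ((((F.P K).L ^ (K - n) : ℝ)) : ℂ) ^ 2 * (((((F.P K).L : ℝ)⁻¹) ^ (K - n) : ℝ) : ℂ) ^ (F.P K).d * ((((((F.P K).L : ℝ)⁻¹) ^ (K - n) : ℝ) : ℂ))⁻¹) •
            (W (fun b => (Complex.I * (((((F.P K).L : ℝ)⁻¹) ^ (K - n) : ℝ) : ℂ))⁻¹ • ((X b : lieSU (Fin N)) : Matrix (Fin N) (Fin N) ℂ)) j - (((N : ℂ))⁻¹ * (W (fun b => (Complex.I * (((((F.P K).L : ℝ)⁻¹) ^ (K - n) : ℝ) : ℂ))⁻¹ • ((X b : lieSU (Fin N)) : Matrix (Fin N) (Fin N) ℂ)) j).trace) • (1 : Matrix (Fin N) (Fin N) ℂ)))) ∧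
        ∀ j, ((Complex.I * ((((F.P K).L ^ (K - n) : ℝ)) : ℂ) ^ 2 * (((((F.P K).L : ℝ)⁻¹) ^ (K - n) : ℝ) : ℂ) ^ (F.P K).d * ((((((F.P K).L : ℝ)⁻¹) ^ (K - n) : ℝ) : ℂ))⁻¹) •
            (W (fun b => (Complex.I * (((((F.P K).L : ℝ)⁻¹) ^ (K - n) : ℝ) : ℂ))⁻¹ • ((X b : lieSU (Fin N)) : Matrix (Fin N) (Fin N) ℂ)) j - (((N : ℂ))⁻¹ * (W (fun b => (Complex.I * (((((F.P K).L : ℝ)⁻¹) ^ (K - n) : ℝ) : ℂ))⁻¹ • ((X b : lieSU (Fin N)) : Matrix (Fin N) (Fin N) ℂ)) j).trace) • (1 : Matrix (Fin N) (Fin N) ℂ))).trace = 0) := by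
  obtain ⟨Mh₀, R₀, ε, C₄, hε, hC₄, hmain⟩ := exists_sectF_W_flatScaled_atRecord_socket N F
  refine ⟨Mh₀, R₀, ε, C₄, hε, hC₄, ?_⟩
  intro n K hk1 hk' Mh R a' hMha hMh hR hsize D hDk hAdm w hw
  obtain ⟨τ, ρ, BE, B, hc, hwa, MV, H, Dsel, Qt, Ht, Dt, e, W, hntr, hρ, hBE, hB, hMV, hH, h55, hcd, hfix, hherm, hQt, hHt, hDt, he, h157,
    hdiff, h158, hsock⟩ := hmain n K hk1 hk' hMha hMh hR hsize D hDk hAdm hw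
  refine ⟨τ, ρ, BE, B, hc, hwa, MV, H, Dsel, Qt, Ht, Dt, e, W, hntr, hρ, hBE, hB, hMV, hH, h55, hcd, hfix, hherm, hQt, hHt, hDt, he, h157,
    hdiff, h158, hsock, ?_, ?_⟩
  · -- `hWq` (§3 `row98_flatCurrentA1` on D‴'s (98) row)
    have hL0 : (0 : ℝ) < ((F.P K).L : ℝ) := by exact_mod_cast (F.P K).L_pos
    have hη0 : (0 : ℝ) < ((((F.P K).L : ℝ)⁻¹) ^ (K - n)) := pow_pos (inv_pos.2 hL0) _
    intro Y r hr h1 h2 b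
    exact row98_flatCurrentA1 (P := F.P K) ((((F.P K).L : ℝ)⁻¹) ^ (K - n)) ((F.P K).L ^ (K - n) : ℝ) hη0 w (fun b => levWeight_nonneg hw 3 b) W h158 Y r hr h1 h2 b
  · -- `hWA` ∧ `hWtr` (§3 over §2's herm0-line reality of the current at every Hermitian-traceless point of the window)
    have hL0 : (0 : ℝ) < ((F.P K).L : ℝ) := by exact_mod_cast (F.P K).L_pos
    have hη0 : (0 : ℝ) < ((((F.P K).L : ℝ)⁻¹) ^ (K - n)) := pow_pos (inv_pos.2 hL0) _
    obtain ⟨hτ, hτs⟩ := ntr_letters τ hntr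
    have hMsa : ∀ X : BondIdx D → Matrix (Fin N) (Fin N) ℂ, (∀ s, IsSelfAdjoint (X s)) →
        ∀ t, IsSelfAdjoint ((((((((F.P K).L : ℝ)⁻¹) ^ (K - n) : ℝ) : ℂ) ^ (F.P K).d) • MV) X t) := fun X hX t =>
      isSelfAdjoint_smul_realKernelC MV _ hMV (by rw [map_pow, Complex.conj_ofReal]) hX t
    have hQsa : ∀ A : PBond (F.P K) 0 → Matrix (Fin N) (Fin N) ℂ, (∀ b, IsSelfAdjoint (A b)) →
        ∀ c, IsSelfAdjoint ((fderiv ℂ (chartLogFlat ((((F.P K).L : ℝ)⁻¹) ^ (K - n)) D : (PBond (F.P K) 0 → Matrix (Fin N) (Fin N) ℂ) → BondIdx D → Matrix (Fin N) (Fin N) ℂ) 0) A c) :=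
      fun A hA c => isSelfAdjoint_fderiv_chartLogFlat_zero ((((F.P K).L : ℝ)⁻¹) ^ (K - n)) D hA c
    have hWreal : ∀ A' : PBond (F.P K) 0 → Matrix (Fin N) (Fin N) ℂ, (∀ b, w 1 b * ‖A' b‖ < ε) →
        (∀ (b : PBond (F.P K) 0) (ν : Fin (F.P K).d), w 2 b * ((F.P K).L : ℝ) ^ (K - n) * ‖A' ⟨b.src.shift ν, b.dir⟩ - A' b‖ < ε) →
        (∀ b, A' b ∈ herm0 (Fin N)) → ∀ δ : PBond (F.P K) 0 → Matrix (Fin N) (Fin N) ℂ, (∀ b, δ b ∈ herm0 (Fin N)) → (∑ b, (W A' b * δ b).trace).im = 0 :=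
      fun A' hA1 hA2 hAh δ hδ =>
        im_sum_trace_current_eq_zero_of_certificate_herm0 hη0.ne' τ hntr BE hBE _ (h157 A' hA1 hA2)
          (hreal_V80_herm0 (K - n) τ hτ hτs B hB H _ hMsa _ hQsa Dsel hherm hA1 hAh) δ hδ
    intro X ρ' hρ' h1 h2
    exact ⟨fun j => conjTranspose_flatCurrentA1_eq_neg ((((F.P K).L : ℝ)⁻¹) ^ (K - n)) ((F.P K).L ^ (K - n) : ℝ) hη0 w W hWreal X hρ' h1 h2 j,
      fun j => trace_flatCurrentA1 ((((F.P K).L : ℝ)⁻¹) ^ (K - n)) ((F.P K).L ^ (K - n) : ℝ) W _ j⟩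

end Record


end Summit.QuantumFields.YangMills.Theorems.K0Stub1FlatCurrentA1LineRowsAtRecord

end
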